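import Mathlib
import Literature.NumberTheory.Transcendental.KZCalculusProofs
import Literature.NumberTheory.Transcendental.SemialgebraicMapsProofs
import Literature.NumberTheory.Transcendental.KZSemialgebraicComplex
import Literature.NumberTheory.Transcendental.KZLogCalculusProofs
import HarnessLib

/-!
# `OffTetraSectorKernel`, line `deform-to-the-oracle`: the substitution `y = 2 − a(1 + s²)` (stub `stub_aToY`)

Stub `stub_aToY` of the crux `OffTetraSectorKernel` (stmt-KontsevichZagierPeriods-10557, route
HyperbolicBloch), line `deform-to-the-oracle`: ONE instance of Kontsevich–Zagier's rule (2)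
(`KZ.changeOfVariablesRel`) for the POLYNOMIAL map `Φ(a, s) = (s, 2 − a(1 + s²))` of the plane.
Coordinates: `v 0 = a`, `v 1 = s` on the half-closed "shadow square" `{0 ≤ a < 1, 0 < s < 1}` and
`x 0 = s`, `x 1 = y` on its image `T' = {0 < s < 1, 1 − s² < y ≤ 2}`.

* `Φ` maps the shadow square BIJECTIVELY onto `T'`: for fixed `s`, `a ↦ 2 − a(1 + s²)` is an affine
  bijection of `[0, 1)` onto `(1 − s², 2]` (slope `−(1 + s²) ≠ 0`), inverse `a = (2 − y)/(1 + s²)`;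
* its derivative is `[[0, 1], [−(1 + s²), −2as]]`, of determinant `1 + s²`;
* the Jacobian identity `1/(2 − a(1 + s²)) = g(s, 2 − a(1 + s²)) · (1 + s²)` with
  `g(x) = 1/((1 + x₀²) x₁)` makes `[square, 1/(2 − a(1 + s²))] − [T', g]` ONE element of
  `KZ.changeOfVariablesRel ⊆ KZ.relations`;
* a representation `[T', g]` EXISTS: `T' = Φ(square)` is `ℚ`-semialgebraic by Tarski–Seidenberg
  (`IsSemialgebraicMapOn.isSemialgebraic_image_holds`), `g` is a quotient of `ℚ`-polynomials with
  denominator `(1 + s²) y > 0` on `T'` (`y > 1 − s² > 0`), and `g` is integrable on `Φ(square)` by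
  Mathlib's change-of-variables criterion
  `MeasureTheory.integrableOn_image_iff_integrableOn_abs_det_fderiv_smul` (the pulled-back density
  `|det DΦ| · g ∘ Φ` IS `1/(2 − a(1 + s²)) = T.integrand` on the square).

References: M. Kontsevich, D. Zagier, *Periods* (2001), §1.2 rule (2); J. Bochnak, M. Coste,
M.-F. Roy, *Real Algebraic Geometry* (1998), §2.2 (Prop. 2.2.6, 2.2.7).
-/

noncomputable section

open Set MeasureTheory MvPolynomial
open Literature.NumberTheory.Transcendental Literature.ModelTheory.ExponentialFields

namespace Summit.KontsevichZagierPeriods.HyperbolicBloch.OffTetraSectorKernel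

/-! ## Algebra of the substitution map -/

/-- The coordinates of the substitution map `Φ(a, s) = (s, 2 − a(1 + s²))`. [folklore] -/
theorem aToY_apply (Φ : (Fin 2 → ℝ) → (Fin 2 → ℝ))
    (hΦ : ∀ v, Φ v = ![v 1, 2 - v 0 * (1 + v 1 ^ 2)]) (v : Fin 2 → ℝ) :
    Φ v 0 = v 1 ∧ Φ v 1 = 2 - v 0 * (1 + v 1 ^ 2) := by
  rw [hΦ]
  exact ⟨rfl, rfl⟩

/-- **The image of the shadow square is `T'`**: `Φ(a, s) = (s, 2 − a(1 + s²))` maps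
`{0 ≤ a < 1, 0 < s < 1}` onto `{0 < s < 1, 1 − s² < y ≤ 2}`; for fixed `s`, `a ↦ 2 − a(1 + s²)` is
an affine bijection of `[0, 1)` onto `(1 − s², 2]`, with inverse `a = (2 − y)/(1 + s²)`.
[folklore] -/
theorem aToY_image (Φ : (Fin 2 → ℝ) → (Fin 2 → ℝ))
    (hΦ : ∀ v, Φ v = ![v 1, 2 - v 0 * (1 + v 1 ^ 2)]) :
    Φ '' {x | 0 ≤ x 0 ∧ x 0 < 1 ∧ 0 < x 1 ∧ x 1 < 1} =
      {x | 0 < x 0 ∧ x 0 < 1 ∧ 1 - x 0 ^ 2 < x 1 ∧ x 1 ≤ 2} := by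
  ext w
  constructor
  · -- `Φ` maps the square into `T'`
    rintro ⟨v, ⟨h0, h1, hs0, hs1⟩, rfl⟩
    obtain ⟨e0, e1⟩ := aToY_apply Φ hΦ v
    simp only [mem_setOf_eq, e0, e1]
    have hq : 0 < 1 + v 1 ^ 2 := by positivity
    refine ⟨hs0, hs1, ?_, ?_⟩
    · have h : v 0 * (1 + v 1 ^ 2) < 1 + v 1 ^ 2 := by nlinarith
      linarith
    · have h : 0 ≤ v 0 * (1 + v 1 ^ 2) := mul_nonneg h0 hq.le
      linarith
  · -- `T'` is covered: `a = (2 − y)/(1 + s²)`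
    rintro ⟨h0, h1, hy, hy2⟩
    have hq : 0 < 1 + w 0 ^ 2 := by positivity
    refine ⟨![(2 - w 1) / (1 + w 0 ^ 2), w 0], ?_, ?_⟩
    · have hlt : (2 - w 1) / (1 + w 0 ^ 2) < 1 := by
        rw [div_lt_one hq]
        linarith
      have hge : 0 ≤ (2 - w 1) / (1 + w 0 ^ 2) := div_nonneg (by linarith) hq.le
      simp only [mem_setOf_eq, Matrix.cons_val_zero, Matrix.cons_val_one, Matrix.cons_val_fin_one]
      exact ⟨hge, hlt, h0, h1⟩
    · rw [hΦ]
      funext i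
      fin_cases i
      · simp
      · simp only [Fin.mk_one, Fin.isValue, Matrix.cons_val_one, Matrix.cons_val_zero,
          Matrix.cons_val_fin_one]
        field_simp
        ring

/-- The substitution map is injective: the second coordinate `s` is kept (as the first coordinate
of the image), and for fixed `s` the map `a ↦ 2 − a(1 + s²)` is affine with slope
`−(1 + s²) ≠ 0`. [folklore] -/
theorem aToY_injective (Φ : (Fin 2 → ℝ) → (Fin 2 → ℝ))
    (hΦ : ∀ v, Φ v = ![v 1, 2 - v 0 * (1 + v 1 ^ 2)]) : Function.Injective Φ := by
  intro v v' h
  obtain ⟨e0, e1⟩ := aToY_apply Φ hΦ v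
  obtain ⟨e0', e1'⟩ := aToY_apply Φ hΦ v'
  have h1 : v 1 = v' 1 := by rw [← e0, ← e0', h]
  have h2 : Φ v 1 = Φ v' 1 := by rw [h]
  rw [e1, e1', ← h1] at h2
  have hq : (1 + v 1 ^ 2) ≠ 0 := by positivity
  have h3 : v 0 * (1 + v 1 ^ 2) = v' 0 * (1 + v 1 ^ 2) := by linarith
  have h4 : v 0 = v' 0 := mul_right_cancel₀ hq h3
  funext i
  fin_cases i
  · exact h4
  · exact h1

/-! ## Semialgebraicity -/

/-- The substitution map is a `ℚ`-semialgebraic map on every `ℚ`-semialgebraic set: it is the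
polynomial map `(X₁, 2 − X₀(1 + X₁²))` with rational coefficients. [folklore] -/
theorem aToY_isSemialgebraicMapOn (Φ : (Fin 2 → ℝ) → (Fin 2 → ℝ))
    (hΦ : ∀ v, Φ v = ![v 1, 2 - v 0 * (1 + v 1 ^ 2)]) {σ : Set (Fin 2 → ℝ)}
    (hσ : IsSemialgebraic ℚ σ) : IsSemialgebraicMapOn ℚ σ Φ := by
  refine (isSemialgebraicMapOn_aeval hσ
    (![X 1, 2 - X 0 * (1 + X 1 ^ 2)] : Fin 2 → MvPolynomial (Fin 2) ℚ)).congr fun x _ => ?_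
  rw [hΦ]
  funext j
  fin_cases j
  · simp
  · simp

/-- The image density `g(x) = 1/((1 + x₀²) x₁)` is a `ℚ`-semialgebraic function on every
`ℚ`-semialgebraic `σ ⊆ {x₁ > 0}`: a quotient of `ℚ`-polynomials whose denominator `(1 + x₀²) x₁`
does not vanish on `σ`. [folklore] -/
theorem aToY_isSemialgebraicFunOn {σ : Set (Fin 2 → ℝ)} (hσ : IsSemialgebraic ℚ σ)
    (hpos : ∀ w ∈ σ, 0 < w 1) :
    IsSemialgebraicFunOn ℚ σ (fun w => 1 / ((1 + w 0 ^ 2) * w 1)) := by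
  have hq : ∀ w ∈ σ, aeval w ((1 + X 0 ^ 2) * X 1 : MvPolynomial (Fin 2) ℚ) ≠ 0 := by
    intro w hw
    have h : (0 : ℝ) < (1 + w 0 ^ 2) * w 1 := mul_pos (by positivity) (hpos w hw)
    simpa using h.ne'
  refine (isSemialgebraicFunOn_aeval_div_aeval hσ 1 ((1 + X 0 ^ 2) * X 1) hq).congr fun w _ => ?_
  simp

/-! ## The derivative -/

/-- **The derivative of the substitution map and its determinant.** `Φ` is polynomial; at every
point it has the Fréchet derivative of matrix `[[0, 1], [−(1 + s²), −2as]]`, of determinant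
`1 + s²`. [folklore] -/
theorem aToY_hasFDerivAt_det (Φ : (Fin 2 → ℝ) → (Fin 2 → ℝ))
    (hΦ : ∀ v, Φ v = ![v 1, 2 - v 0 * (1 + v 1 ^ 2)]) (v : Fin 2 → ℝ) :
    ∃ L : (Fin 2 → ℝ) →L[ℝ] (Fin 2 → ℝ), HasFDerivAt Φ L v ∧ L.det = 1 + v 1 ^ 2 := by
  set M : Matrix (Fin 2) (Fin 2) ℝ := !![0, 1; -(1 + v 1 ^ 2), -(2 * v 0 * v 1)] with hM
  refine ⟨LinearMap.toContinuousLinearMap (Matrix.toLin' M), ?_, ?_⟩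
  · -- derivative, componentwise
    have e0 : HasFDerivAt (fun x : Fin 2 → ℝ => x 0) (ContinuousLinearMap.proj 0) v :=
      hasFDerivAt_apply (𝕜 := ℝ) 0 v
    have e1 : HasFDerivAt (fun x : Fin 2 → ℝ => x 1) (ContinuousLinearMap.proj 1) v :=
      hasFDerivAt_apply (𝕜 := ℝ) 1 v
    have h0 : HasFDerivAt (fun x => Φ x 0)
        ((ContinuousLinearMap.proj 0).comp (LinearMap.toContinuousLinearMap (Matrix.toLin' M)))
        v := by
      have hf : (fun x => Φ x 0) = fun x : Fin 2 → ℝ => x 1 := by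
        funext x
        exact (aToY_apply Φ hΦ x).1
      rw [hf]
      refine e1.congr_fderiv (ContinuousLinearMap.ext fun u => ?_)
      simp [hM, Matrix.toLin'_apply, dotProduct, Fin.sum_univ_two]
    have h1 : HasFDerivAt (fun x => Φ x 1)
        ((ContinuousLinearMap.proj 1).comp (LinearMap.toContinuousLinearMap (Matrix.toLin' M)))
        v := by
      have hf : (fun x => Φ x 1) = fun x : Fin 2 → ℝ => 2 - x 0 * (1 + x 1 * x 1) := by
        funext x
        rw [(aToY_apply Φ hΦ x).2]
        ring
      rw [hf]
      have hcomp := (e0.fun_mul ((e1.fun_mul e1).const_add 1)).const_sub 2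
      refine hcomp.congr_fderiv (ContinuousLinearMap.ext fun u => ?_)
      simp [hM, Matrix.toLin'_apply, dotProduct, Fin.sum_univ_two]
      ring
    refine hasFDerivAt_pi'' fun i => ?_
    fin_cases i
    exacts [h0, h1]
  · -- determinant
    rw [LinearMap.det_toContinuousLinearMap, LinearMap.det_toLin', Matrix.det_fin_two]
    simp [hM]

/-- **Substitution move data**: a derivative `Φ'` of `Φ` at every point together with the
Jacobian identity `1/(2 − a(1 + s²)) = g(Φ v) · |det Φ' v|`, `g(x) = 1/((1 + x₀²) x₁)`
(`(Φ v)₀ = s`, `(Φ v)₁ = 2 − a(1 + s²)`, `|det Φ' v| = 1 + s² ≠ 0`).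
[cite: KontsevichZagier2001, §1.2 rule (2)] -/
theorem aToY_moveData (Φ : (Fin 2 → ℝ) → (Fin 2 → ℝ))
    (hΦ : ∀ v, Φ v = ![v 1, 2 - v 0 * (1 + v 1 ^ 2)]) :
    ∃ Φ' : (Fin 2 → ℝ) → ((Fin 2 → ℝ) →L[ℝ] (Fin 2 → ℝ)), ∀ v, HasFDerivAt Φ (Φ' v) v ∧
      1 / (2 - v 0 * (1 + v 1 ^ 2)) = 1 / ((1 + Φ v 0 ^ 2) * Φ v 1) * |(Φ' v).det| := by
  choose L hL using aToY_hasFDerivAt_det Φ hΦ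
  refine ⟨L, fun v => ⟨(hL v).1, ?_⟩⟩
  obtain ⟨e0, e1⟩ := aToY_apply Φ hΦ v
  have hq : 0 < 1 + v 1 ^ 2 := by positivity
  rw [(hL v).2, e0, e1, abs_of_pos hq, div_mul_eq_mul_div, one_mul, ← div_div, div_self hq.ne']

/-! ## The stub -/

/-- **STUB `stub_aToY`** (the substitution `y = 2 − a(1 + s²)`; Kontsevich–Zagier's rule (2) for
the polynomial map `Φ(a, s) = (s, 2 − a(1 + s²))` of the shadow square `{0 ≤ a < 1, 0 < s < 1}`
onto `T' = {0 < s < 1, 1 − s² < y ≤ 2}`). For every shadow-square representation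
`T = [square, 1/(2 − a(1 + s²))]`: a representation `[T', 1/((1 + s²) y)]` EXISTS (semialgebraic
image by Tarski–Seidenberg; quotient integrand with denominator `(1 + s²) y > 0`; integrable by the
change-of-variables criterion, the pulled-back density `|det DΦ| · 1/((1 + s²)(2 − a(1 + s²)))`
being `1/(2 − a(1 + s²)) = T.integrand` on the square), and EVERY such representation is
KZ-equivalent to `T` by the single move `[T] − [T'] ∈ changeOfVariablesRel` (`Φ` semialgebraic,
injective, derivative `[[0, 1], [−(1 + s²), −2as]]`, image `T'`,
`1/(2 − a(1 + s²)) = (1/((1 + x₀²) x₁)) ∘ Φ · |det DΦ|`).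
[cite: KontsevichZagier2001, §1.2 rule (2)] -/
theorem stub_aToY : ∀ T : Literature.NumberTheory.Transcendental.KZ.IntegralRep 2, T.domain = {x | 0 ≤ x 0 ∧ x 0 < 1 ∧ 0 < x 1 ∧ x 1 < 1} → Set.EqOn T.integrand (fun x => 1 / (2 - x 0 * (1 + x 1 ^ 2))) T.domain → (∃ T' : Literature.NumberTheory.Transcendental.KZ.IntegralRep 2, T'.domain = {x | 0 < x 0 ∧ x 0 < 1 ∧ 1 - x 0 ^ 2 < x 1 ∧ x 1 ≤ 2} ∧ Set.EqOn T'.integrand (fun x => 1 / ((1 + x 0 ^ 2) * x 1)) T'.domain) ∧ (∀ T' : Literature.NumberTheory.Transcendental.KZ.IntegralRep 2, T'.domain = {x | 0 < x 0 ∧ x 0 < 1 ∧ 1 - x 0 ^ 2 < x 1 ∧ x 1 ≤ 2} → Set.EqOn T'.integrand (fun x => 1 / ((1 + x 0 ^ 2) * x 1)) T'.domain → Literature.NumberTheory.Transcendental.KZ.Equivalent T T') := by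
  intro T hT hTi
  -- the move `Φ(a, s) = (s, 2 − a(1 + s²))`
  set Φ : (Fin 2 → ℝ) → (Fin 2 → ℝ) := fun v => ![v 1, 2 - v 0 * (1 + v 1 ^ 2)] with hΦdef
  have hΦ : ∀ v, Φ v = ![v 1, 2 - v 0 * (1 + v 1 ^ 2)] := fun _ => rfl
  -- the image is `T'`
  have himage : Φ '' T.domain = {x | 0 < x 0 ∧ x 0 < 1 ∧ 1 - x 0 ^ 2 < x 1 ∧ x 1 ≤ 2} := by
    rw [hT]
    exact aToY_image Φ hΦ
  -- the four data of the move
  have hΦsa : IsSemialgebraicMapOn ℚ T.domain Φ :=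
    aToY_isSemialgebraicMapOn Φ hΦ T.isSemialgebraic_domain
  have hinj : InjOn Φ T.domain := (aToY_injective Φ hΦ).injOn
  obtain ⟨Φ', hΦ'⟩ := aToY_moveData Φ hΦ
  have hderiv : ∀ x ∈ T.domain, HasFDerivWithinAt Φ (Φ' x) T.domain x := fun x _ =>
    (hΦ' x).1.hasFDerivWithinAt
  have hjac : ∀ x ∈ T.domain, T.integrand x =
      1 / ((1 + Φ x 0 ^ 2) * Φ x 1) * |(Φ' x).det| := by
    intro x hx
    rw [hTi hx]
    exact (hΦ' x).2
  have hmeas : MeasurableSet T.domain := KZ.IntegralRep.measurableSet_domain_holds T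
  -- EXISTENCE of `[T', 1/((1 + s²) y)]`: semialgebraic image, quotient integrand, change of variables
  have hσ : IsSemialgebraic ℚ (Φ '' T.domain) :=
    IsSemialgebraicMapOn.isSemialgebraic_image_holds hΦsa subset_rfl T.isSemialgebraic_domain
  have hpos : ∀ w ∈ Φ '' T.domain, 0 < w 1 := by
    rw [himage]
    rintro w ⟨h0, h1, hy, -⟩
    have h : w 0 ^ 2 < 1 := by nlinarith
    linarith
  have hF := aToY_isSemialgebraicFunOn hσ hpos
  have hI : IntegrableOn (fun w : Fin 2 → ℝ => 1 / ((1 + w 0 ^ 2) * w 1)) (Φ '' T.domain) := by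
    rw [integrableOn_image_iff_integrableOn_abs_det_fderiv_smul volume hmeas hderiv hinj]
    refine T.integrableOn.congr_fun (fun x hx => ?_) hmeas
    rw [hjac x hx, smul_eq_mul, mul_comm]
  refine ⟨⟨⟨Φ '' T.domain, _, hσ, hF, hI⟩, himage, fun _ _ => rfl⟩, ?_⟩
  -- EVERY `[T', 1/((1 + s²) y)]` is one change-of-variables move away from `T`
  intro V hV hVi
  refine KZ.changeOfVariablesRel_subset_relations
    ⟨2, T, V, Φ, Φ', hΦsa, hderiv, hinj, hV.trans himage.symm, fun x hx => ?_, rfl⟩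
  have hx' : Φ x ∈ V.domain := by
    rw [hV, ← himage]
    exact mem_image_of_mem Φ hx
  rw [hjac x hx, hVi hx']

end Summit.KontsevichZagierPeriods.HyperbolicBloch.OffTetraSectorKernel

end
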